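import Summits.NavierStokesRegularity.FluidComputer.RowCircuitTime
import Summits.NavierStokesRegularity.FluidComputer.RowChainForceQ
import HarnessLib

/-!
# Layer R, perturbed class U: every solution of the FORCED circuit with a uniformly small forcing
# runs the certified itinerary (`pub-fluidc-bp3/R1-DESIGN.md` §11.9; on top of `RowCircuitTime`)

HONEST FRAMING (cell `pub-fluidc`, blueprint seat bp3, gen 22): low prior, high value-of-information
experiment on Tao's machine paradigm; NOT a claim that NS blows up.

WHAT. The first ROBUST version of the one-scale transfer. For ANY continuous forcing `δF` in the
uniform class `U` (`|δF(σ)ₐ| ≤ δU a`, `δU = 2⁻¹⁹ / 2⁻²⁹`, `RowChainForceQ.δUQ`) and ANY global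
solution `y` of the forced circuit `ẏ = F gK ΛK (y) + δF(σ)` from an admissible start (lock
coordinate `b₁` exact, frame box `u₀`): at a physical time `τ` with `|τ − Tc 1066| ≤ ∑ρₖHₖ +
Ds₆₅₆/2^P + Ds₉₈₆/2^P` the state is within `Ē₁₀₆₅` of `XEND` (`forced_timed_from`); from the
designed start `X0`: `|τ − 19/20| ≤ 1/200`, `a₂(τ) ≥ 2409/2500`, `|yₐ(τ)| ≤ capQ a`
(`forced_transfer`).
Proof: `RowChain.enclosure_timed` with `D = univ`; its disturbance tests (`htube`, the two switch
windows) are discharged UNIFORMLY by `force_budgetQ` (`δU ≤ DELₖ/2^P` on all 1066 rows). The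
existence of the global solution is the caller's (energy is no longer conserved); the class `U` is
tiny (it is the kernel's per-row slack, not a coupling model) — the state-dependent classes of
§11.9 are successor work. [cite: Tao2016AveragedNS, §5.5 Thm 5.3 (5.5)]
-/

noncomputable section

namespace Summit.NavierStokesRegularity.FluidComputer

open Literature.Analysis.FluidPDE.FluidComputer

namespace RowChain

open RowCheck RowCheck.RowData RowRun ChainField Set

/-- `δU ≤ δₖ` (the row's disturbance allowance, as a real). [folklore] -/
theorem δU_le_δR (k : ℕ) (hk : k < 1066) (a : Fin 9) : (δUQ a : ℝ) ≤ (row k).δR a := by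
  have h := force_budgetQ k hk a
  have h' : ((δUQ a : ℚ) : ℝ) ≤ ((((row k).DEL a : ℚ) / 2 ^ (row k).P : ℚ) : ℝ) := by
    exact_mod_cast h
  push_cast at h'
  exact h'

/-- `δU ≤ max(DELₖ, DELₖ')/2^P` (the switch-window allowance). [folklore] -/
theorem δU_le_win (k k' : ℕ) (hk : k' < 1066) (a : Fin 9) :
    (δUQ a : ℝ) ≤ ((max ((row k).DEL a) ((row k').DEL a) : ℤ) : ℝ) / 2 ^ (row k').P := by
  refine (δU_le_δR k' hk a).trans ?_
  show (((row k').DEL a : ℤ) : ℝ) / 2 ^ (row k').P ≤ _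
  exact div_le_div_of_nonneg_right (by exact_mod_cast le_max_right _ _) (by positivity)

/-- **The forced circuit, timed, from any admissible start** (class `U`). [folklore] -/
theorem forced_timed_from {q₀ : Fin 9 → ℝ} (hlock : q₀ (row 0).p = X0 (row 0).p)
    (hbox : ∀ i, |z0 q₀ i| ≤ (row 0).ubR 0 i) {y δF : ℝ → Fin 9 → ℝ} (hy0 : y 0 = q₀)
    (hy : ∀ σ, HasDerivAt y (F gK ΛK (y σ) + δF σ) σ) (hδc : Continuous δF)
    (hδ : ∀ σ a, |δF σ a| ≤ (δUQ a : ℝ)) :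
    ∃ τ : ℝ, |τ - Tc 1066| ≤ ∑ k ∈ Finset.range 1066, (row k).rhoR * (row k).Hq +
        (cert656.Ds : ℝ) / 2 ^ (row 657).P + (cert986.Ds : ℝ) / 2 ^ (row 987).P ∧
      ∀ a, |y τ a - XEND a| ≤ (row 1065).EbarR a := by
  have hyc : Continuous y := continuous_iff_continuousAt.2 fun σ => (hy σ).continuousAt
  obtain ⟨sA, sdA, sB, sdB, sD, sdD, hs0, h, hrow, o₁, o₂⟩ := enclosure_timed Tc Tc_succ (y := y)
    (δF := δF) (D := univ) isOpen_univ
    (fun σ _ a => by simpa using (hasDerivAt_pi.1 (hy σ)) a)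
    (fun k _ => by
      have hc : Continuous fun σ => F gK ΛK (y σ) (row k).p + δF σ (row k).p :=
        ((continuous_apply (row k).p).comp ((continuous_F gK ΛK).comp hyc)).add
          ((continuous_apply (row k).p).comp hδc)
      exact hc.continuousOn)
    (fun k hk σ _ t _ _ a => (hδ σ a).trans (δU_le_δR k hk a))
    (fun K _ _ => subset_univ _)
    (fun σ _ _ => ⟨subset_univ _, fun ξ _ a => (hδ ξ a).trans (δU_le_win 656 657 (by norm_num) a)⟩)
    (fun σ _ _ => ⟨subset_univ _, fun ξ _ a => (hδ ξ a).trans (δU_le_win 986 987 (by norm_num) a)⟩)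
    (σ₀ := 0) (mem_univ _) (by rw [hy0, hlock]; rfl)
    (fun i => by
      rw [z_start_eq_z0 (Tc 0) y δF univ (fun _ => 0) (fun _ => 0) rfl hy0]
      exact hbox i)
  refine ⟨sD (Tc 1066), ?_, fun a => ?_⟩
  · have hc := chain_time Tc (fun k => ((row k).Hq : ℝ)) (fun k => (row k).rhoR) Tc_succ sA sB sD
      hs0 (fun k hk => by have := hrow k (by omega); rwa [mOf_A hk] at this)
      (fun k hk hk' => by have := hrow k (by omega); rwa [mOf_B hk hk'] at this)
      (fun k hk hk' => by have := hrow k hk'; rwa [mOf_D hk] at this) o₁ o₂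
    rw [Tc_zero] at hc
    simpa using hc
  · obtain ⟨-, htube, -, -⟩ := h 1065 (by norm_num)
    have ht : Tc 1066 ∈ Icc (Tc 1065) (Tc (1065 + 1)) := by
      refine ⟨?_, le_rfl⟩
      rw [show Tc 1066 = Tc 1065 + (row 1065).Hq from Tc_succ 1065]
      have hH : (0 : ℝ) < (row 1065).Hq := Hq_pos ((runOK_iff _).mp (runOK_row 1065)).1
      linarith
    have h1 := htube (Tc 1066) ht a
    rw [mOf_D (by norm_num)] at h1
    have hH : Tc 1066 - Tc 1065 = (row 1065).Hq := by
      rw [show Tc 1066 = Tc 1065 + (row 1065).Hq from Tc_succ 1065]; ring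
    have he : (toModel (canon (framesOK_row 1065)) (G 1065) (Tc 1065) ⟨y, δF, univ, sD, sdD⟩).e
        (Tc 1066) a = y (sD (Tc 1066)) a - XEND a := by
      show y (sD (Tc 1066)) a - xh (row 1065).CQ (Tc 1066 - Tc 1065) a = _
      rw [hH]
      rfl
    rw [he] at h1
    exact h1

/-- **The robust one-scale transfer (class `U`)**: every global solution of the forced circuit
from `X0` with `|δF| ≤ δU` reaches `a₂ ≥ 0.9636` (caps `capQ`) at a time `τ`, `|τ − 0.95| ≤ 1/200`.
[cite: Tao2016AveragedNS, §5.5 Thm 5.3 (5.5)] -/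
theorem forced_transfer {y δF : ℝ → Fin 9 → ℝ} (hy0 : y 0 = X0)
    (hy : ∀ σ, HasDerivAt y (F gK ΛK (y σ) + δF σ) σ) (hδc : Continuous δF)
    (hδ : ∀ σ a, |δF σ a| ≤ (δUQ a : ℝ)) :
    ∃ τ : ℝ, |τ - 19 / 20| ≤ 1 / 200 ∧ (2409 : ℝ) / 2500 ≤ y τ 4 ∧
      ∀ a, |y τ a| ≤ (capQ a : ℝ) := by
  obtain ⟨τ, hτ, hend⟩ := forced_timed_from (q₀ := X0) rfl
    (fun i => by rw [z0_X0, abs_zero]; exact ubR_zero_nonneg_row 0 i) hy0 hy hδc hδ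
  obtain ⟨hb, hT⟩ := time_budget
  refine ⟨τ, ?_, end_readout _ hend⟩
  have h1 : |τ - Tc 1066| ≤ 1 / 600 + 1 / 700 := hτ.trans hb
  have h2 := abs_sub_le τ (Tc 1066) (19 / 20)
  linarith

end RowChain

end Summit.NavierStokesRegularity.FluidComputer
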